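import Summits.HodgeConjecture.HodgeConjecture.Theorems.SignSymmetricPowersGenDiagonalCoeff
import Literature.Computability.AlgebraicComplexity.FormSingularLocusPrime
import HarnessLib

/-!
# K1-B meridian package, G2 part (f): linear substitutions commuting with the diagonal action; every member of
# the orbit of a form singular at a point is singular (route `SignSymmetricPowers`, item stmt-HodgeConjecture-19716)

Helper file (`--supports stmt-HodgeConjecture-19716`) for the COVERAGE step of GEN (`stub_signMeridianGeneration`):
the irreducible components of the restricted discriminant `V(D_M)` are presented as orbits, under the linear
substitutions commuting with the diagonal symmetry `γ`, of LINEAR families of `M`-supported forms singular at a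
fixed reference point.  This file supplies the pointwise ingredients, on top of the `val-lit` cell's
`Literature.Computability.AlgebraicComplexity.linSubst` (`(A · F)(x) = F(Aᵀ x)`, `FormDiscriminant.eval_linSubst_eq`,
`pderiv_linSubst_eq_sum`):

* `aeval_diagSubstK_eq_linSubst` — the diagonal action `σ_γ` IS `linSubst (diagonal γ)`;
* `aeval_diagSubstK_linSubst_of_commute` — if `A` commutes with `diagonal γ` then `σ_γ (A · F) = A · (σ_γ F)`, so `A ·`
  preserves `γ`-invariant forms (`linSubst_invariant_of_commute`), and the inverse of such `A` commutes too
  (`nonsing_inv_commute_diagonal`);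
* `isSupportedOn_iff_aeval_diagSubstK_eq` — for `M = {m | γ^m = 1}` a degree-`d` form is `M`-supported iff it is
  `γ`-invariant;
* `eval_pderiv_linSubst`, `not_isNonsingularForm_linSubst_of_singular_at` — the chain rule at a point and **every
  `A · F` (any matrix `A`, `F` of degree `d ≥ 2` with `∇F(p) = 0` at some `p ≠ 0`) is a singular form** (cone over
  `ker Aᵀ`, or the moved singular point).

Sorry-free; axioms standard; no definition, no named fact.

## References

* [Hartshorne1977] R. Hartshorne, Algebraic Geometry, I Ex. 5.8 (Jacobian criterion).
* [Katz2009] N. M. Katz, Another look at the Dwork family, §3 (diagonal torus action).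
-/

noncomputable section

set_option linter.dupNamespace false

open MvPolynomial Matrix
open Literature.AlgebraicGeometry.Motives Literature.AlgebraicGeometry.Motives.UniversalHypersurface
open Literature.AlgebraicGeometry.HodgeTheory
open Literature.Computability.AlgebraicComplexity

namespace Summit.HodgeConjecture.HodgeConjecture.Theorems.SignSymmetricPowersGenLinSubst

variable {n : ℕ} (γ : Fin (n + 2) → ℂˣ)

/-! ### §1 The diagonal action is a linear substitution; commuting substitutions preserve invariants -/

/-- `σ_γ = linSubst (diagonal γ)`. [cite: Katz2009, §3] -/
theorem aeval_diagSubstK_eq_linSubst :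
    (aeval (diagSubstK ℂ n γ) : MvPolynomial (Fin (n + 2)) ℂ →ₐ[ℂ] MvPolynomial (Fin (n + 2)) ℂ) =
      linSubst (Fin (n + 2)) ℂ (Matrix.diagonal fun i => (γ i : ℂ)) := by
  classical
  refine MvPolynomial.algHom_ext fun i => ?_
  rw [aeval_X, linSubst_X, Finset.sum_eq_single i]
  · rw [Matrix.diagonal_apply_eq, diagSubstK, smul_eq_C_mul]
  · intro j _ hji; rw [Matrix.diagonal_apply_ne _ hji, zero_smul]
  · intro h; exact absurd (Finset.mem_univ i) h

/-- If `A` commutes with `diagonal γ` then `σ_γ (A · F) = A · (σ_γ F)`. [cite: Katz2009, §3] -/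
theorem aeval_diagSubstK_linSubst_of_commute {A : Matrix (Fin (n + 2)) (Fin (n + 2)) ℂ}
    (hA : A * Matrix.diagonal (fun i => (γ i : ℂ)) = Matrix.diagonal (fun i => (γ i : ℂ)) * A)
    (F : MvPolynomial (Fin (n + 2)) ℂ) :
    aeval (diagSubstK ℂ n γ) (linSubst (Fin (n + 2)) ℂ A F) = linSubst (Fin (n + 2)) ℂ A (aeval (diagSubstK ℂ n γ) F) := by
  rw [aeval_diagSubstK_eq_linSubst, ← AlgHom.comp_apply, ← linSubst_mul, ← hA, linSubst_mul, AlgHom.comp_apply]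

/-- Hence `A ·` preserves `γ`-invariant forms when `A` commutes with `diagonal γ`. [cite: Katz2009, §3] -/
theorem linSubst_invariant_of_commute {A : Matrix (Fin (n + 2)) (Fin (n + 2)) ℂ}
    (hA : A * Matrix.diagonal (fun i => (γ i : ℂ)) = Matrix.diagonal (fun i => (γ i : ℂ)) * A)
    {F : MvPolynomial (Fin (n + 2)) ℂ} (hF : aeval (diagSubstK ℂ n γ) F = F) :
    aeval (diagSubstK ℂ n γ) (linSubst (Fin (n + 2)) ℂ A F) = linSubst (Fin (n + 2)) ℂ A F := by
  rw [aeval_diagSubstK_linSubst_of_commute γ hA, hF]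

/-- The inverse of an invertible matrix commuting with `D` commutes with `D`. [folklore] -/
theorem nonsing_inv_commute {m : Type*} [Fintype m] [DecidableEq m] {A D : Matrix m m ℂ} (hdet : IsUnit A.det)
    (hA : A * D = D * A) : A⁻¹ * D = D * A⁻¹ := by
  have h1 : A⁻¹ * (A * D) * A⁻¹ = A⁻¹ * (D * A) * A⁻¹ := by rw [hA]
  rw [← Matrix.mul_assoc, Matrix.nonsing_inv_mul _ hdet, Matrix.one_mul, Matrix.mul_assoc, Matrix.mul_assoc,
    Matrix.mul_nonsing_inv _ hdet, Matrix.mul_one] at h1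
  exact h1.symm

/-! ### §2 `M`-supported = `γ`-invariant, for the monomials fixed by `γ` -/

variable {d : ℕ} (M : Set (DegIndex n d))

/-- If `M` is exactly the set of degree-`d` monomials fixed by `γ` (`γ^m = 1`), a degree-`d` form is `M`-supported
iff it is `γ`-invariant. [cite: Katz2009, §3] -/
theorem isSupportedOn_iff_aeval_diagSubstK_eq (hM : ∀ m : DegIndex n d, m ∈ M ↔ unitWeight ℂ n γ m.1 = 1)
    {F : MvPolynomial (Fin (n + 2)) ℂ} (hF : F.IsHomogeneous d) :
    IsSupportedOn n d M F ↔ aeval (diagSubstK ℂ n γ) F = F := by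
  constructor
  · intro h
    exact aeval_diagSubstK_of_isSupportedOn (fun m hm => (hM m).mp hm) hF h
  · intro h m hm
    -- compare the `m`-th coefficients of `σ_γ F = F`
    have hc := congr_arg (coeff m.1) h
    conv_lhs at hc => rw [← sum_monomial_coeff_eq n d F hF, map_sum]
    simp only [aeval_diagSubstK_monomial, coeff_sum, coeff_monomial] at hc
    rw [Finset.sum_eq_single m] at hc
    · simp only [if_true] at hc
      have hw : (unitWeight ℂ n γ m.1 : ℂ) ≠ 1 := by
        intro h1; exact hm ((hM m).mpr (Units.val_eq_one.mp h1))
      -- `w c = c` with `w ≠ 1` forces `c = 0`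
      have : ((unitWeight ℂ n γ m.1 : ℂ) - 1) * coeff m.1 F = 0 := by rw [sub_mul, one_mul, hc, sub_self]
      rcases mul_eq_zero.mp this with h0 | h0
      · exact absurd (sub_eq_zero.mp h0) hw
      · exact h0
    · intro m' _ hm'
      rw [if_neg]
      exact fun h => hm' (Subtype.ext h)
    · intro h'; exact absurd (Finset.mem_univ m) h'

/-! ### §3 The chain rule at a point; every `A · F` with `∇F(p) = 0` is singular -/

/-- `∂ⱼ(A · F)(x) = Σ_l A j l · (∂_l F)(Aᵀ x)`. [cite: Hartshorne1977, I Ex. 5.8] -/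
theorem eval_pderiv_linSubst (A : Matrix (Fin (n + 2)) (Fin (n + 2)) ℂ) (F : MvPolynomial (Fin (n + 2)) ℂ)
    (j : Fin (n + 2)) (x : Fin (n + 2) → ℂ) :
    MvPolynomial.eval x (pderiv j (linSubst (Fin (n + 2)) ℂ A F)) =
      ∑ l, A j l * MvPolynomial.eval (Aᵀ *ᵥ x) (pderiv l F) := by
  rw [pderiv_linSubst_eq_sum, map_sum]
  refine Finset.sum_congr rfl fun l _ => ?_
  rw [smul_eval, FormDiscriminant.eval_linSubst_eq]

/-- A homogeneous form of positive degree vanishes at the origin. [folklore] -/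
theorem eval_zero_of_isHomogeneous {F : MvPolynomial (Fin (n + 2)) ℂ} {e : ℕ} (hF : F.IsHomogeneous e) (he : e ≠ 0) :
    MvPolynomial.eval (0 : Fin (n + 2) → ℂ) F = 0 := by
  rw [MvPolynomial.eval_zero]
  exact hF.coeff_eq_zero (by rw [map_zero]; exact Ne.symm he)

/-- **Every member of the orbit family is singular**: if `F` is homogeneous of degree `d ≥ 2` with `∇F(p) = 0` at
some `p ≠ 0`, then for EVERY matrix `A` the form `A · F` is not nonsingular (if `Aᵀ` kills some `z ≠ 0`, `A · F`
is a cone singular at `z`; otherwise `z = (Aᵀ)⁻¹ p ≠ 0` is a singular point).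
[cite: Hartshorne1977, I Ex. 5.8] -/
theorem not_isNonsingularForm_linSubst_of_singular_at (hd : 2 ≤ d) {F : MvPolynomial (Fin (n + 2)) ℂ}
    (hF : F.IsHomogeneous d) {p : Fin (n + 2) → ℂ} (hp : p ≠ 0) (hpd : ∀ j, MvPolynomial.eval p (pderiv j F) = 0)
    (A : Matrix (Fin (n + 2)) (Fin (n + 2)) ℂ) :
    ¬ SmoothHypersurface.IsNonsingularForm ℂ (linSubst (Fin (n + 2)) ℂ A F) := by
  classical
  intro hns
  -- a point `z ≠ 0` with `Aᵀ z ∈ {0, p}`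
  obtain ⟨z, hz, hAz⟩ : ∃ z : Fin (n + 2) → ℂ, z ≠ 0 ∧ (Aᵀ *ᵥ z = 0 ∨ Aᵀ *ᵥ z = p) := by
    by_cases hdet : Aᵀ.det = 0
    · obtain ⟨z, hz, hAz⟩ := Matrix.exists_mulVec_eq_zero_iff.2 hdet
      exact ⟨z, hz, Or.inl hAz⟩
    · have hunit : IsUnit Aᵀ.det := Ne.isUnit hdet
      refine ⟨Aᵀ⁻¹ *ᵥ p, ?_, Or.inr ?_⟩
      · intro h0
        apply hp
        have : Aᵀ *ᵥ (Aᵀ⁻¹ *ᵥ p) = 0 := by rw [h0, Matrix.mulVec_zero]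
        rwa [Matrix.mulVec_mulVec, Matrix.mul_nonsing_inv _ hunit, Matrix.one_mulVec] at this
      · rw [Matrix.mulVec_mulVec, Matrix.mul_nonsing_inv _ hunit, Matrix.one_mulVec]
  -- `F` and all its partials vanish at `Aᵀ z`
  have hd1 : 1 ≤ d := le_trans (by norm_num) hd
  have hFp : MvPolynomial.eval p F = 0 := by
    have hE := hF.sum_X_mul_pderiv
    have h1 : MvPolynomial.eval p (∑ i, X i * pderiv i F) = 0 := by
      rw [map_sum]; exact Finset.sum_eq_zero fun i _ => by rw [map_mul, hpd i, mul_zero]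
    rw [hE, map_nsmul, nsmul_eq_mul] at h1
    have hd' : ((d : ℕ) : ℂ) ≠ 0 := by exact_mod_cast (show d ≠ 0 by omega)
    exact (mul_eq_zero.mp h1).resolve_left hd'
  have hval : MvPolynomial.eval (Aᵀ *ᵥ z) F = 0 := by
    rcases hAz with h | h
    · rw [h]; exact eval_zero_of_isHomogeneous hF (by omega)
    · rw [h]; exact hFp
  have hder : ∀ l, MvPolynomial.eval (Aᵀ *ᵥ z) (pderiv l F) = 0 := by
    intro l
    rcases hAz with h | h
    · rw [h]; exact eval_zero_of_isHomogeneous (hF.pderiv (i := l)) (by omega)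
    · rw [h]; exact hpd l
  obtain ⟨j, hj⟩ := hns.exists_eval_pderiv_ne_zero hz (by rw [FormDiscriminant.eval_linSubst_eq]; exact hval)
  apply hj
  rw [eval_pderiv_linSubst]
  exact Finset.sum_eq_zero fun l _ => by rw [hder l, mul_zero]

/-- The same, read on coefficient vectors: `coeffsOf (A · F) ∈ singularCoeffs`.
[cite: EisenbudHarris2016, §7.1 Prop. 7.1] -/
theorem coeffsOf_linSubst_mem_singularCoeffs (hd : 2 ≤ d) {F : MvPolynomial (Fin (n + 2)) ℂ}
    (hF : F.IsHomogeneous d) {p : Fin (n + 2) → ℂ} (hp : p ≠ 0) (hpd : ∀ j, MvPolynomial.eval p (pderiv j F) = 0)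
    (A : Matrix (Fin (n + 2)) (Fin (n + 2)) ℂ) :
    coeffsOf n d (linSubst (Fin (n + 2)) ℂ A F) ∈ singularCoeffs n d := by
  rw [mem_singularCoeffs_iff, formOfCoeffs_coeffsOf n d (linSubst_isHomogeneous A hF)]
  exact not_isNonsingularForm_linSubst_of_singular_at hd hF hp hpd A

/-! ### §4 Moving a singular point: `F := A⁻¹ · f` is singular at `p` when `f` is singular at `z = (A⁻¹)ᵀ p` -/

/-- If `f` is singular at `z` and `Aᵀ z' = z`... precisely: `∇(A · f)(x) = 0` whenever `∇f(Aᵀ x) = 0`.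
[cite: Hartshorne1977, I Ex. 5.8] -/
theorem eval_pderiv_linSubst_eq_zero (A : Matrix (Fin (n + 2)) (Fin (n + 2)) ℂ) {f : MvPolynomial (Fin (n + 2)) ℂ}
    {x : Fin (n + 2) → ℂ} (hf : ∀ l, MvPolynomial.eval (Aᵀ *ᵥ x) (pderiv l f) = 0) (j : Fin (n + 2)) :
    MvPolynomial.eval x (pderiv j (linSubst (Fin (n + 2)) ℂ A f)) = 0 := by
  rw [eval_pderiv_linSubst]
  exact Finset.sum_eq_zero fun l _ => by rw [hf l, mul_zero]

/-- `A · (A⁻¹ · f) = f` for invertible `A`. [cite: Landsberg2017, §1.2] -/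
theorem linSubst_linSubst_nonsing_inv {A : Matrix (Fin (n + 2)) (Fin (n + 2)) ℂ} (hA : IsUnit A.det)
    (f : MvPolynomial (Fin (n + 2)) ℂ) :
    linSubst (Fin (n + 2)) ℂ A (linSubst (Fin (n + 2)) ℂ A⁻¹ f) = f := by
  rw [← AlgHom.comp_apply, ← linSubst_mul, Matrix.mul_nonsing_inv _ hA, linSubst_one, AlgHom.id_apply]

end Summit.HodgeConjecture.HodgeConjecture.Theorems.SignSymmetricPowersGenLinSubst

end
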